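import Summits.QuantumFields.BalabanUV.Beta.GAN24.SrecWilsonSector

/-!
# `BalabanUV.Beta.GAN24.SrecAtRowOfSectors` — binder row G-an2-4 / (CONV-C), CT-ROUTE: THE SOCKET «hS0 FOR THE RECURSIVE COMB FAMILY `SrecAt` FROM ITS
# TWO SECTORS» — the Wilson lineage `wilsonSecAt` (hS0: the owner's `WilsonSectorRow` ∕ `WilsonSectorRowHolds`) and the border∕Λ-born remainder `bornSecAt`
# (hS0: leaf-02's CT-3aV∕CT-3aH cells + leaf-03's (E-α-V) + the «CT-3cV» assembly, in flight), by leaf-03 g52's `SrecAt_eq_wilsonSecAt_add_bornSecAt` and the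
# additivity of the change of units (row owner, `gen19/CT3-MECHANISM-v1.2.md` §C∕§D; generic `d`)

NOT IN PRINT; OUR BOOKKEEPING ([folklore]: `SrecWilsonSector.SrecAt_eq_wilsonSecAt_add_bornSecAt` + `StencilSlotOfShapes.unitS_add` + lit `locStencil_add` at the
common rate; no estimate, no cited fact, no `def`, no `def … : Prop`).  HONEST FRAMING (cell contract, verbatim): «discharging `BetaPertH` makes Bałaban's UV
stability UNCONDITIONAL — a real constructive-QFT result; it is NOT the continuum limit and NOT the Clay problem.»  HONEST DEPENDENCY (verbatim): «continuum YM on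
T⁴ ⇐ BetaPertH ∧ nine spine estimates (0/9 proved); BetaPertH ⇐ (D1) ∧ (D4) ∧ CAP+tail; G-an2-4 gates asym, D1 and NE2/3/4.»  Discharges NOTHING by itself (both
sector letters are HYPOTHESES here); when both land, `hSrow` for the comb family `SrecAt` is two `exact`s; the sym family `JsB12Sym` is CT-5.  NEVER «G-an2-4 closed»
as (CONV-C); NOT D1, NOT `BetaPertH`, NOT continuum, NOT Clay.
Unit `b2b-balaban-gan24-p1` (row owner G-an2-4, gen 19), 2026-08-21.
-/

noncomputable section

open Literature.MathematicalPhysics.QuantumFieldTheory.Balaban1983to89.Beta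
open OneStepResolventKernel (LocStencil)
open StepJetData (locStencil_add)
open AffineAveraging (box toSite)
open Summit.QuantumFields.BalabanUV.Beta.HessKerDressedUnits (unitS)
open Summit.QuantumFields.BalabanUV.Beta.GAN24.CombesThomas (sfStep smStep)
open Summit.QuantumFields.BalabanUV.Beta.WardLocusRecursive (SrecAt)
open Summit.QuantumFields.BalabanUV.Beta.GAN24.SrecWilsonSector (wilsonSecAt bornSecAt SrecAt_eq_wilsonSecAt_add_bornSecAt)
open Summit.QuantumFields.BalabanUV.Beta.GAN24.StencilSlotOfShapes (unitS_add locStencil_mono')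

namespace Summit.QuantumFields.BalabanUV.Beta.GAN24.SrecAtRowOfSectors

variable {d Lc : ℕ} [NeZero Lc]

/-- NOT IN PRINT; OUR BOOKKEEPING.  **hS0 FOR THE COMB RECURSIVE FAMILY FROM ITS TWO SECTORS** (generic `d`, any coefficients): uniform-in-`j` local-stencil
letters for the unit tables of the Wilson lineage `wilsonSecAt` and of the remainder `bornSecAt` (each with ONE constant and ONE rate for all levels and all
in-block roots) give the same for `SrecAt` — constant `Cw + Cb`, rate `min δw δb`. -/
theorem exists_hS0_SrecAt_of_sectors (cE cVH cΛ : ℝ)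
    (hW : ∃ Cw δw : ℝ, 0 < δw ∧ ∀ (rr : Fin (d + 1) → ℕ), rr ∈ box (d + 1) Lc →
      ∀ j : ℕ, LocStencil (unitS (sfStep Lc j) (smStep d Lc j) (wilsonSecAt Lc (toSite rr) cE j)) Cw δw)
    (hB : ∃ Cb δb : ℝ, 0 < δb ∧ ∀ (rr : Fin (d + 1) → ℕ), rr ∈ box (d + 1) Lc →
      ∀ j : ℕ, LocStencil (unitS (sfStep Lc j) (smStep d Lc j) (bornSecAt Lc (toSite rr) cE cVH cΛ j)) Cb δb) :
    ∃ Cs δS : ℝ, 0 < δS ∧ ∀ (rr : Fin (d + 1) → ℕ), rr ∈ box (d + 1) Lc →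
      ∀ j : ℕ, LocStencil (unitS (sfStep Lc j) (smStep d Lc j) (SrecAt d Lc (toSite rr) cE cVH cΛ j)) Cs δS := by
  obtain ⟨Cw, δw, hδw, hW⟩ := hW
  obtain ⟨Cb, δb, hδb, hB⟩ := hB
  refine ⟨Cw + Cb, min δw δb, lt_min hδw hδb, fun rr hrr j => ?_⟩
  rw [SrecAt_eq_wilsonSecAt_add_bornSecAt, unitS_add]
  exact locStencil_add (locStencil_mono' (hW rr hrr j) le_rfl (min_le_left _ _)) (locStencil_mono' (hB rr hrr j) le_rfl (min_le_right _ _))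

/-- NOT IN PRINT; OUR BOOKKEEPING.  The same with the sector letters quantified root by root (constants may be chosen per root; useful when a cell bound is proved for one
fixed in-block root). -/
theorem locStencil_unitS_SrecAt_of_sectors (cE cVH cΛ : ℝ) {rr : Fin (d + 1) → ℕ} {Cw δw Cb δb : ℝ}
    (hW : ∀ j : ℕ, LocStencil (unitS (sfStep Lc j) (smStep d Lc j) (wilsonSecAt Lc (toSite rr) cE j)) Cw δw)
    (hB : ∀ j : ℕ, LocStencil (unitS (sfStep Lc j) (smStep d Lc j) (bornSecAt Lc (toSite rr) cE cVH cΛ j)) Cb δb) (j : ℕ) :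
    LocStencil (unitS (sfStep Lc j) (smStep d Lc j) (SrecAt d Lc (toSite rr) cE cVH cΛ j)) (Cw + Cb) (min δw δb) := by
  rw [SrecAt_eq_wilsonSecAt_add_bornSecAt, unitS_add]
  exact locStencil_add (locStencil_mono' (hW j) le_rfl (min_le_left _ _)) (locStencil_mono' (hB j) le_rfl (min_le_right _ _))

end Summit.QuantumFields.BalabanUV.Beta.GAN24.SrecAtRowOfSectors

end
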